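import Literature.Geometry.Lorentzian.TwoParameterMaps
import Literature.Geometry.Lorentzian.GeodesicSpeed
import Literature.Geometry.Lorentzian.CurveThroughVelocity
import Literature.Geometry.Lorentzian.CausalityProofs
import Literature.Geometry.Lorentzian.Stationary
import Literature.Geometry.Lorentzian.CompleteStationaryVacuumFlatProofs
import Literature.Geometry.Manifold.CompleteFlow
import HarnessLib

/-!
# The flow of a Killing vector field consists of time-orientation-preserving isometries

In the Lorentz prelude a **Killing field** of a pseudo-Riemannian metric `g` is a `C^n` vector
field `X` satisfying the Killing equation `g(∇_Y X, Z) + g(Y, ∇_Z X) = 0`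
(`PseudoRiemannianMetric.IsKillingField`, `LeviCivita.lean`; O'Neill 1983, Ch. 9, Prop. 9.25),
whereas the literature on stationary black holes works with the **one-parameter group of
isometries `φₜ[X]`** generated by `X` (Chruściel–Costa, Astérisque 321 (2008) = arXiv:0806.0016,
§2.2: "let `φₜ[X] : M → M` denote the one-parameter group of diffeomorphisms generated by `X`";
`M_ext := ⋃ₜ φₜ(Σ_ext)`, and throughout §3–§4 "invariant under the flow of `X`"). This file
proves the link — O'Neill 1983, Ch. 9, Prop. 9.23, in the direction *Killing equation ⟹ the
flow maps are isometries* — together with its causal consequences, for a flow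
`θ : ℝ × M → M` of `X` given as data (`θ` of class `C²`, `θ(0, p) = p`, each `t ↦ θ(t, p)` an
integral curve of `X`, and where needed the group law `θ(t, θ(s, p)) = θ(t + s, p)`; for a
complete field such a `θ` exists by
`Literature.Geometry.Manifold.exists_contMDiff_globalFlow_of_complete`, Lee 2012, Thm. 9.12):

* `IsKillingField.hasDerivAt_val_velocity_curry_right`, `….val_velocity_curry_right_eq` — the
  first-variation identity: for a two-parameter map `x(t, s)` whose `t`-curves are flow lines of
  the Killing field `X`, `(d/dt) g(x_s, x_s) = 2 g(x_{st}, x_s) = 2 g(x_{ts}, x_s) =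
  2 g(∇_{x_s} X, x_s) = 0` (metric compatibility along curves, `hasDerivAt_val_apply_along`; the
  symmetry lemma `x_{st} = x_{ts}`, `covariantDerivAlong_velocity_comm`, O'Neill Ch. 4,
  Prop. 4.44 (1); `D(X ∘ γ)/ds = ∇_{γ'} X`, `covariantDerivAlong_comp_holds`, O'Neill Ch. 3,
  Prop. 3.18 (3); and the Killing equation) — this is the computation behind O'Neill's Prop. 9.23;
* `IsKillingField.val_mfderiv_flow_self`, `IsKillingField.val_mfderiv_flow` — **the flow maps are
  isometries**: `g_{θₜ p}(dθₜ v, dθₜ w) = g_p(v, w)` (realise `v` as `c'(0)` for the chart-straight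
  curve `c`, `velocity_curveThrough_zero_holds`, and polarise);
* `isHomeomorph_flow`, `mfderiv_flow_neg_apply_mfderiv_flow`, `mfderiv_flow_ne_zero` — with the
  group law, `θₜ` is a homeomorphism with inverse `θ₋ₜ` and `dθ₋ₜ ∘ dθₜ = id`;
* `IsKillingField.isTimelike_mfderiv_flow_iff`, `….isCausal_mfderiv_flow`,
  `….isFutureDirected_mfderiv_flow` — for a time-oriented Lorentzian metric the flow maps preserve
  the causal character **and the time orientation** of tangent vectors (the function
  `t ↦ g(T, dθₜ v)` is continuous, nowhere zero and negative at `t = 0`);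
* `IsKillingField.isFutureTimelikeCurveOn_flow_comp`, `….isFutureCausalCurveOn_flow_comp`,
  `….image_flow_chronologicalFuture`, `….image_flow_chronologicalPast` — hence `θₜ` maps future
  timelike/causal curves to future timelike/causal curves and `θₜ(I^±(A)) = I^±(θₜ(A))`;
* `image_flow_stationaryOrbit` and `IsKillingField.image_flow_{chronologicalFuture,
  chronologicalPast}_stationaryOrbit`, `….image_flow_docOfEnd`, `….image_flow_blackHoleRegionOfEnd`,
  `….image_flow_frontier_blackHoleRegionOfEnd`, `….image_flow_futureEventHorizonOfEnd`,
  `….flow_mem_futureEventHorizonOfEnd`, `….flow_mem_docOfEnd` — for `M_ext = ⋃ₛ φₛ(A)`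
  (`stationaryOrbit`, `Stationary.lean`): `M_ext`, `I^±(M_ext)`, the domain of outer communications
  `⟨⟨M_ext⟩⟩`, the black-hole region `𝓑 = M ∖ I⁻(M_ext)`, the event horizon `𝓗⁺ = ∂𝓑` and the
  future event horizon `𝓔⁺ = ∂I⁻(M_ext) ∩ I⁺(M_ext)` are all invariant under every `θₜ`
  (Chruściel–Costa 2008, §2.2 and the first line of the proof of Lemma 3.6: "the null achronal
  boundaries `İ^∓(C) ∩ M_ext` are invariant under the flow of `X`"; Prop. 4.1:
  `𝓔₀ = ⋃ₜ φₜ(S₀)`);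
* `StationaryAFBlackHole.exists_stationary_flow` — the packaged statement for the hypothesis
  structure of the black-hole uniqueness theorem gr.S23 (Chruściel–Costa 2008, Thm. 1.3,
  `Literature.Geometry.Lorentzian.StationaryBlackHoleUniqueness`): the complete stationary Killing
  field `X₀` of `𝓑` generates a smooth global flow by time-orientation-preserving isometries leaving
  `𝓑.Mext`, `I^±(𝓑.Mext)`, `𝓑.doc`, `𝓑.blackHoleRegion` and `𝓑.horizon` invariant.

Everything is proved (no named facts); the Lorentzian statements are placed in the namespace
`PseudoRiemannianMetric.IsKillingField` of their hypothesis for dot notation. This is a brick of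
the printed proof of Chruściel–Costa's Theorem 1.3 (companion of
`Literature.Geometry.Lorentzian.StationaryBlackHoleUniquenessProofs`), kept in its own file because
it is general Killing-field theory.

## References

* B. O'Neill, *Semi-Riemannian geometry with applications to relativity*, Academic Press 1983,
  Ch. 9, Def. 9.22, Prop. 9.23 (Killing fields and flows by isometries), Prop. 9.25 (Killing
  equation), pp. 250–252; Ch. 4, Prop. 4.44 (1) (symmetry lemma); Ch. 3, Prop. 3.18; Ch. 5,
  Lemma 5.26 ff. (key `ONeillSemiRiemannian1983`).
* P. T. Chruściel, J. L. Costa, *On uniqueness of stationary vacuum black holes*, Astérisque 321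
  (2008) 195–265, arXiv:0806.0016, §2.2 ((2.1)–(2.6), `φₜ[X]`), §3 (Lemmas 3.4, 3.6), §4.1
  (Prop. 4.1) (key `ChruscielCosta2008`).
* J. M. Lee, *Introduction to Smooth Manifolds*, 2nd ed., GTM 218, Springer 2012, Thm. 9.12
  (fundamental theorem on flows) (key `LeeSmoothManifolds2013`).
-/

noncomputable section

open Bundle Set Filter Function
open scoped Manifold ContDiff Topology

namespace Literature.Geometry.Lorentzian

universe u

variable {E : Type*} [NormedAddCommGroup E] [NormedSpace ℝ E] {H : Type*} [TopologicalSpace H]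
  {I : ModelWithCorners ℝ E H} {M : Type*} [TopologicalSpace M] [ChartedSpace H M]
  [IsManifold I ∞ M] {n : ℕ∞ω}

/-! ### Velocities of composite curves -/

omit [IsManifold I ∞ M] in
/-- Chain rule for velocities: the velocity of `f ∘ c` at `s` is `df_{c s}(c'(s))` (a private copy
of `velocity_comp` of `GaussFormulaTangential.lean`, to keep the imports of this file light). [folklore] -/
private theorem velocity_comp' {E' : Type*} [NormedAddCommGroup E'] [NormedSpace ℝ E'] {H' : Type*}
    [TopologicalSpace H'] {I' : ModelWithCorners ℝ E' H'} {M' : Type*} [TopologicalSpace M']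
    [ChartedSpace H' M'] {f : M → M'} {c : ℝ → M} {s : ℝ}
    (hf : MDifferentiableAt I I' f (c s)) (hc : MDifferentiableAt 𝓘(ℝ, ℝ) I c s) :
    velocity I' (f ∘ c) s = mfderiv I I' f (c s) (velocity I c s) := by
  unfold velocity
  rw [mfderiv_comp s hf hc]
  rfl

/-! ### The group law: `θₜ` is a bijection (a homeomorphism) with inverse `θ₋ₜ` -/

section FlowGroup

variable {N : Type*} {θ : ℝ × N → N}

/-- `θ₋ₜ ∘ θₜ = id` for a flow with the group law. Lee 2012, Thm. 9.12 (b). [cite: LeeSmoothManifolds2013, Thm. 9.12 (b)] -/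
theorem flow_neg_apply_flow (hθ0 : ∀ p, θ (0, p) = p)
    (hθadd : ∀ t s p, θ (t, θ (s, p)) = θ (t + s, p)) (t : ℝ) (p : N) : θ (-t, θ (t, p)) = p := by
  rw [hθadd, neg_add_cancel, hθ0]

/-- `θₜ ∘ θ₋ₜ = id` for a flow with the group law. Lee 2012, Thm. 9.12 (b). [cite: LeeSmoothManifolds2013, Thm. 9.12 (b)] -/
theorem flow_apply_flow_neg (hθ0 : ∀ p, θ (0, p) = p)
    (hθadd : ∀ t s p, θ (t, θ (s, p)) = θ (t + s, p)) (t : ℝ) (p : N) : θ (t, θ (-t, p)) = p := by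
  rw [hθadd, add_neg_cancel, hθ0]

/-- The image of a set under `θₜ` is its preimage under `θ₋ₜ`. [folklore] -/
theorem image_flow_eq_preimage_flow_neg (hθ0 : ∀ p, θ (0, p) = p)
    (hθadd : ∀ t s p, θ (t, θ (s, p)) = θ (t + s, p)) (t : ℝ) (A : Set N) :
    (fun p ↦ θ (t, p)) '' A = (fun p ↦ θ (-t, p)) ⁻¹' A := by
  ext q
  constructor
  · rintro ⟨p, hp, rfl⟩
    simpa [flow_neg_apply_flow hθ0 hθadd] using hp
  · intro hq
    exact ⟨θ (-t, q), hq, flow_apply_flow_neg hθ0 hθadd t q⟩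

/-- `θₜ(θ₋ₜ(A)) = A`. [folklore] -/
theorem image_flow_image_flow_neg (hθ0 : ∀ p, θ (0, p) = p)
    (hθadd : ∀ t s p, θ (t, θ (s, p)) = θ (t + s, p)) (t : ℝ) (A : Set N) :
    (fun p ↦ θ (t, p)) '' ((fun p ↦ θ (-t, p)) '' A) = A := by
  rw [Set.image_image]
  simp [flow_apply_flow_neg hθ0 hθadd]

/-- **`θₜ` is a homeomorphism** (continuous with continuous inverse `θ₋ₜ`). Lee 2012,
Thm. 9.12. [cite: LeeSmoothManifolds2013, Thm. 9.12] -/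
theorem isHomeomorph_flow [TopologicalSpace N] (hθc : Continuous θ) (hθ0 : ∀ p, θ (0, p) = p)
    (hθadd : ∀ t s p, θ (t, θ (s, p)) = θ (t + s, p)) (t : ℝ) : IsHomeomorph fun p ↦ θ (t, p) :=
  isHomeomorph_iff_exists_inverse.2 ⟨hθc.comp (continuous_const.prodMk continuous_id),
    fun p ↦ θ (-t, p), flow_neg_apply_flow hθ0 hθadd t, flow_apply_flow_neg hθ0 hθadd t,
    hθc.comp (continuous_const.prodMk continuous_id)⟩

end FlowGroup

/-! ### The first variation of `g(x_s, x_s)` along the flow lines of a Killing field -/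

namespace PseudoRiemannianMetric

variable [FiniteDimensional ℝ E] [CompleteSpace E] [Fact (1 ≤ n)]
  {g : PseudoRiemannianMetric I n E (TangentSpace I : M → Type _)} [g.HasLeviCivita]
  {X : Π x : M, TangentSpace I x}

/-- **`g(x_s, x_s)` is stationary along the flow lines of a Killing field.** Let `X` be a Killing
field and `x : ℝ → ℝ → M` a two-parameter map, `C²` at `(t₀, s₀)`, all of whose `t`-parameter
curves `t ↦ x(t, s)` are integral curves of `X` (a one-parameter family of flow lines). Then the
function `t ↦ g(x_s, x_s)(t, s₀)` has derivative `0` at `t₀`. Printed argument (O'Neill 1983,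
Ch. 9, proof of Prop. 9.23 with Lemma 9.21; Chruściel–Costa 2008, §2.2 use the conclusion
"`φₜ[X]` is a one-parameter group of isometries"): by metric compatibility
`(d/dt) g(x_s, x_s) = 2 g(x_{st}, x_s)`; by the symmetry lemma `x_{st} = x_{ts}` (O'Neill Ch. 4,
Prop. 4.44 (1)); `x_t = X ∘ x`, so `x_{ts} = ∇_{x_s} X` (O'Neill Ch. 3, Prop. 3.18 (3)); and
`g(∇_{x_s} X, x_s) = 0` is the Killing equation (Prop. 9.25). [cite: ONeillSemiRiemannian1983, Ch. 9, Prop. 23 and Prop. 25 (pp. 251–252)] -/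
theorem IsKillingField.hasDerivAt_val_velocity_curry_right (hX : g.IsKillingField X)
    {x : ℝ → ℝ → M} {t₀ s₀ : ℝ}
    (hx : ContMDiffAt (𝓘(ℝ, ℝ).prod 𝓘(ℝ, ℝ)) I 2 (uncurry x) (t₀, s₀))
    (hflow : ∀ s, IsMIntegralCurve (fun t ↦ x t s) X) :
    HasDerivAt (fun t ↦ g.val (x t s₀) (velocity I (x t) s₀) (velocity I (x t) s₀)) 0 t₀ := by
  have hLC : g.IsLeviCivita g.leviCivita := isLeviCivita_leviCivita_holds
  -- the partial velocity `x_s` along the flow line `t ↦ x t s₀` has a differentiable lift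
  have hS := mdifferentiableAt_lift_velocity_curry_right hx
  have h := hasDerivAt_val_apply_along (g := g) hLC.2 hS hS
  -- `x_{st} = x_{ts} = ∇_{x_s} X`
  have hcomm := covariantDerivAlong_velocity_comm g.leviCivita hLC.1 hx
  have hvel : (fun s ↦ velocity I (fun t ↦ x t s) t₀) = fun s ↦ X (x t₀ s) :=
    funext fun s ↦ velocity_eq_of_isMIntegralCurve (hflow s) t₀
  have hcomp : covariantDerivAlong g.leviCivita (x t₀) (fun s ↦ X (x t₀ s)) s₀ =
      g.leviCivita X (x t₀ s₀) (velocity I (x t₀) s₀) :=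
    covariantDerivAlong_comp_holds g.leviCivita (mdifferentiableAt_curry_right hx two_ne_zero)
      (hX.mdifferentiableAt _)
  rw [hcomm, hvel, hcomp] at h
  have h0 : g.val (x t₀ s₀) (g.leviCivita X (x t₀ s₀) (velocity I (x t₀) s₀))
      (velocity I (x t₀) s₀) + g.val (x t₀ s₀) (velocity I (x t₀) s₀)
        (g.leviCivita X (x t₀ s₀) (velocity I (x t₀) s₀)) = 0 :=
    hX.val_leviCivita_add (x t₀ s₀) _ _
  rwa [h0] at h

/-- **`g(x_s, x_s)` is constant along the flow lines of a Killing field**: under the hypotheses of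
`hasDerivAt_val_velocity_curry_right` at every `(t, s₀)`, `t ∈ ℝ`, the function
`t ↦ g(x_s, x_s)(t, s₀)` is constant. O'Neill 1983, Ch. 9, Prop. 9.23. [cite: ONeillSemiRiemannian1983, Ch. 9, Prop. 23 (p. 251)] -/
theorem IsKillingField.val_velocity_curry_right_eq (hX : g.IsKillingField X) {x : ℝ → ℝ → M}
    {s₀ : ℝ} (hx : ∀ t, ContMDiffAt (𝓘(ℝ, ℝ).prod 𝓘(ℝ, ℝ)) I 2 (uncurry x) (t, s₀))
    (hflow : ∀ s, IsMIntegralCurve (fun t ↦ x t s) X) (t : ℝ) :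
    g.val (x t s₀) (velocity I (x t) s₀) (velocity I (x t) s₀) =
      g.val (x 0 s₀) (velocity I (x 0) s₀) (velocity I (x 0) s₀) :=
  is_const_of_deriv_eq_zero
    (fun t ↦ (hX.hasDerivAt_val_velocity_curry_right (hx t) hflow).differentiableAt)
    (fun t ↦ (hX.hasDerivAt_val_velocity_curry_right (hx t) hflow).deriv) t 0

/-! ### The flow maps `θₜ = θ(t, ·)` of a Killing field are isometries

Setting for the rest of the file: `θ : ℝ × M → M` is a *flow of `X`* — a `C²` map with
`θ(0, p) = p` whose curves `t ↦ θ(t, p)` are integral curves of `X` (for a complete `C^k` field,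
`k ≥ 2`, on a Hausdorff manifold without boundary such a `θ`, with the group law, is produced by
`Literature.Geometry.Manifold.exists_contMDiff_globalFlow_of_complete`). We write the hypotheses
out rather than bundling them. -/

section Flow

variable [I.Boundaryless] {θ : ℝ × M → M}

omit [IsManifold I ∞ M] [FiniteDimensional ℝ E] [CompleteSpace E] [Fact (1 ≤ n)] [g.HasLeviCivita]
  [I.Boundaryless] in
/-- The flow map `θₜ` is `C²` (hence differentiable) at every point. [folklore] -/
theorem mdifferentiableAt_flow (hθ : ContMDiff (𝓘(ℝ, ℝ).prod I) I 2 θ) (t : ℝ) (p : M) :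
    MDifferentiableAt I I (fun q ↦ θ (t, q)) p :=
  ((hθ.comp (contMDiff_const.prodMk contMDiff_id)).contMDiffAt (x := p)).mdifferentiableAt
    two_ne_zero

omit [FiniteDimensional ℝ E] [CompleteSpace E] [Fact (1 ≤ n)] [g.HasLeviCivita] in
/-- **Realising `dθₜ v` as a partial velocity.** For the flow `θ` and a tangent vector
`v ∈ T_p M` there is a curve `c` through `p`, `C²` at `0`, with `c'(0) = v` (the chart-straight
curve), such that the two-parameter map `x(t, s) = θ(t, c(s))` is `C²` at every `(t, 0)` and its
partial velocity there is `x_s(t, 0) = dθₜ v` (chain rule). O'Neill 1983, Ch. 1, Prop. 1.16 and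
Ex. 5; Ch. 4, p. 122. [cite: ONeillSemiRiemannian1983, Ch. 4, p. 122] -/
theorem exists_curve_velocity_flow_eq_mfderiv (hθ : ContMDiff (𝓘(ℝ, ℝ).prod I) I 2 θ) (p : M)
    (v : TangentSpace I p) :
    ∃ c : ℝ → M, c 0 = p ∧ ContMDiffAt 𝓘(ℝ, ℝ) I 2 c 0 ∧ velocity I c 0 = v ∧
      (∀ t, ContMDiffAt (𝓘(ℝ, ℝ).prod 𝓘(ℝ, ℝ)) I 2 (uncurry fun t s ↦ θ (t, c s)) (t, 0)) ∧
      ∀ t, velocity I (fun s ↦ θ (t, c s)) 0 = mfderiv I I (fun q ↦ θ (t, q)) p v := by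
  obtain ⟨c, hc_def⟩ : ∃ c : ℝ → M, c = curveThrough I p v := ⟨_, rfl⟩
  have hc : ContMDiffAt 𝓘(ℝ, ℝ) I 2 c 0 := hc_def ▸ contMDiffAt_curveThrough_zero p v
  have hc0 : c 0 = p := by rw [hc_def, curveThrough_zero]
  have hv0 : velocity I c 0 = v := by
    rw [hc_def]
    exact velocity_curveThrough_zero_holds (I := I) (M := M) BoundarylessManifold.isInteriorPoint v
  refine ⟨c, hc0, hc, hv0, fun t ↦ ?_, fun t ↦ ?_⟩
  · have h2 : ContMDiffAt (𝓘(ℝ, ℝ).prod 𝓘(ℝ, ℝ)) I 2 (fun q : ℝ × ℝ ↦ c q.2) (t, 0) :=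
      hc.comp (t, 0) contMDiffAt_snd
    have h1 : ContMDiffAt (𝓘(ℝ, ℝ).prod 𝓘(ℝ, ℝ)) (𝓘(ℝ, ℝ).prod I) 2
        (fun q : ℝ × ℝ ↦ ((q.1, c q.2) : ℝ × M)) (t, 0) :=
      contMDiffAt_fst.prodMk h2
    exact (hθ (t, c 0)).comp (t, 0) h1
  · have h := velocity_comp' (f := fun q ↦ θ (t, q)) (c := c) (s := 0)
      (mdifferentiableAt_flow hθ t (c 0)) (hc.mdifferentiableAt two_ne_zero)
    rw [hv0, hc0] at h
    exact h

omit [FiniteDimensional ℝ E] [CompleteSpace E] [Fact (1 ≤ n)] [g.HasLeviCivita] in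
/-- **`t ↦ (θₜ p, dθₜ v)` is a continuous curve in `TM`** (it is the partial velocity field `x_s`
along a flow line of the `C²` two-parameter map of `exists_curve_velocity_flow_eq_mfderiv`, whose
lift is even differentiable). O'Neill 1983, Ch. 4, p. 122. [cite: ONeillSemiRiemannian1983, Ch. 4, p. 122] -/
theorem continuous_lift_mfderiv_flow (hθ : ContMDiff (𝓘(ℝ, ℝ).prod I) I 2 θ) (p : M)
    (v : TangentSpace I p) :
    Continuous fun t ↦
      (TotalSpace.mk' E (θ (t, p)) (mfderiv I I (fun q ↦ θ (t, q)) p v) : TangentBundle I M) := by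
  obtain ⟨c, hc0, -, -, hx, hS⟩ := exists_curve_velocity_flow_eq_mfderiv hθ p v
  subst hc0
  have h : (fun t ↦ (TotalSpace.mk' E (θ (t, c 0)) (mfderiv I I (fun q ↦ θ (t, q)) (c 0) v) :
      TangentBundle I M)) = fun t ↦
        TotalSpace.mk' E (θ (t, c 0)) (velocity I (fun s ↦ θ (t, c s)) 0) :=
    funext fun t ↦ by rw [hS t]
  rw [h]
  exact continuous_iff_continuousAt.2 fun t ↦
    (mdifferentiableAt_lift_velocity_curry_right (hx t)).continuousAt

/-- **The flow of a Killing field preserves the quadratic form of the metric**: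
`g_{θₜ p}(dθₜ v, dθₜ v) = g_p(v, v)` for every `t`, `p` and `v ∈ T_p M`. Realise `v` as the velocity
at `s = 0` of the chart-straight curve `c` through `p` (`exists_curve_velocity_flow_eq_mfderiv`) and
apply `val_velocity_curry_right_eq` to the two-parameter map `x(t, s) = θ(t, c(s))`, whose
`t`-curves are flow lines: `x_s(t, 0) = dθₜ(c'(0)) = dθₜ v` and `x(0, ·) = c`. O'Neill 1983, Ch. 9,
Prop. 9.23 ("`X` is Killing iff `L_X g = 0`", the flow-by-isometries direction); Chruściel–Costa
2008, §2.2. [cite: ONeillSemiRiemannian1983, Ch. 9, Prop. 23 (p. 251)] -/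
theorem IsKillingField.val_mfderiv_flow_self (hX : g.IsKillingField X)
    (hθ : ContMDiff (𝓘(ℝ, ℝ).prod I) I 2 θ) (hθ0 : ∀ p, θ (0, p) = p)
    (hθX : ∀ p, IsMIntegralCurve (fun t ↦ θ (t, p)) X) (t : ℝ) (p : M) (v : TangentSpace I p) :
    g.val (θ (t, p)) (mfderiv I I (fun q ↦ θ (t, q)) p v) (mfderiv I I (fun q ↦ θ (t, q)) p v) =
      g.val p v v := by
  obtain ⟨c, hc0, -, hv0, hx, hS⟩ := exists_curve_velocity_flow_eq_mfderiv hθ p v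
  have hflow : ∀ s, IsMIntegralCurve (fun t ↦ (fun t s ↦ θ (t, c s)) t s) X := fun s ↦ hθX (c s)
  have key := hX.val_velocity_curry_right_eq hx hflow t
  have hx0 : (fun s ↦ θ (0, c s)) = c := funext fun s ↦ hθ0 (c s)
  have key' : g.val (θ (t, c 0)) (velocity I (fun s ↦ θ (t, c s)) 0)
      (velocity I (fun s ↦ θ (t, c s)) 0) = g.val (θ (0, c 0)) (velocity I (fun s ↦ θ (0, c s)) 0)
        (velocity I (fun s ↦ θ (0, c s)) 0) := key
  rw [hx0, hθ0 (c 0), hv0, hc0, hS] at key'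
  exact key'

/-- **The flow maps of a Killing field are infinitesimal isometries**:
`g_{θₜ p}(dθₜ v, dθₜ w) = g_p(v, w)` for all `t`, `p`, `v, w ∈ T_p M` (polarisation of
`val_mfderiv_flow_self`). O'Neill 1983, Ch. 9, Prop. 9.23; this is the statement "the
one-parameter group of diffeomorphisms `φₜ[X]` generated by the Killing vector `X` consists of
isometries" used throughout Chruściel–Costa 2008 (§2.2, §3, §4). [cite: ONeillSemiRiemannian1983, Ch. 9, Prop. 23 (p. 251)] -/
theorem IsKillingField.val_mfderiv_flow (hX : g.IsKillingField X)
    (hθ : ContMDiff (𝓘(ℝ, ℝ).prod I) I 2 θ) (hθ0 : ∀ p, θ (0, p) = p)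
    (hθX : ∀ p, IsMIntegralCurve (fun t ↦ θ (t, p)) X) (t : ℝ) (p : M)
    (v w : TangentSpace I p) :
    g.val (θ (t, p)) (mfderiv I I (fun q ↦ θ (t, q)) p v) (mfderiv I I (fun q ↦ θ (t, q)) p w) =
      g.val p v w := by
  have q := fun u ↦ hX.val_mfderiv_flow_self hθ hθ0 hθX t p u
  have h1 := q (v + w)
  simp only [map_add, FunLike.coe_add, Pi.add_apply] at h1
  rw [g.symm _ (mfderiv I I (fun q ↦ θ (t, q)) p w) (mfderiv I I (fun q ↦ θ (t, q)) p v),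
    g.symm p w v, q v, q w] at h1
  linarith

/-! ### The differential of a flow map is injective -/

omit [IsManifold I ∞ M] [FiniteDimensional ℝ E] [CompleteSpace E] [Fact (1 ≤ n)] [g.HasLeviCivita]
  [I.Boundaryless] in
/-- **`dθ₋ₜ ∘ dθₜ = id`**: the differential of a flow map is injective (indeed invertible).
Lee 2012, Thm. 9.12 / Prop. 9.13 ff. [cite: LeeSmoothManifolds2013, Thm. 9.12] -/
theorem mfderiv_flow_neg_apply_mfderiv_flow (hθ : ContMDiff (𝓘(ℝ, ℝ).prod I) I 2 θ)
    (hθ0 : ∀ p, θ (0, p) = p) (hθadd : ∀ t s p, θ (t, θ (s, p)) = θ (t + s, p)) (t : ℝ) (p : M)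
    (v : TangentSpace I p) :
    mfderiv I I (fun q ↦ θ (-t, q)) (θ (t, p)) (mfderiv I I (fun q ↦ θ (t, q)) p v) = v := by
  have hcomp : (fun q ↦ θ (-t, q)) ∘ (fun q ↦ θ (t, q)) = id :=
    funext fun q ↦ flow_neg_apply_flow hθ0 hθadd t q
  have h := mfderiv_comp p (mdifferentiableAt_flow hθ (-t) (θ (t, p)))
    (mdifferentiableAt_flow hθ t p)
  rw [hcomp, mfderiv_id] at h
  exact (ContinuousLinearMap.ext_iff.1 h v).symm

omit [IsManifold I ∞ M] [FiniteDimensional ℝ E] [CompleteSpace E] [Fact (1 ≤ n)] [g.HasLeviCivita]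
  [I.Boundaryless] in
/-- The differential of a flow map kills no non-zero vector. [cite: LeeSmoothManifolds2013, Thm. 9.12] -/
theorem mfderiv_flow_ne_zero (hθ : ContMDiff (𝓘(ℝ, ℝ).prod I) I 2 θ) (hθ0 : ∀ p, θ (0, p) = p)
    (hθadd : ∀ t s p, θ (t, θ (s, p)) = θ (t + s, p)) (t : ℝ) {p : M} {v : TangentSpace I p}
    (hv : v ≠ 0) : mfderiv I I (fun q ↦ θ (t, q)) p v ≠ 0 := by
  intro h0
  have h := mfderiv_flow_neg_apply_mfderiv_flow hθ hθ0 hθadd t p v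
  rw [h0, map_zero] at h
  exact hv h.symm

end Flow

end PseudoRiemannianMetric

/-! ### Time orientation: the flow of a Killing field of `(M, g, τ)` preserves `τ`

(The statements below concern a Lorentzian metric `g`; they are placed in the namespace
`PseudoRiemannianMetric.IsKillingField` of their hypothesis `hX : g.IsKillingField X` so that they
can be invoked by dot notation.) -/

namespace PseudoRiemannianMetric

variable [FiniteDimensional ℝ E] [CompleteSpace E] [Fact (1 ≤ n)] [I.Boundaryless]
  {g : LorentzianMetric I n M} [g.HasLeviCivita] {τ : TimeOrientation g}
  {X : Π x : M, TangentSpace I x} {θ : ℝ × M → M}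

/-- The flow of a Killing field maps timelike vectors to timelike vectors. O'Neill 1983, Ch. 9,
Prop. 9.23 (isometries preserve causal character). [cite: ONeillSemiRiemannian1983, Ch. 9, Prop. 23 (p. 251)] -/
theorem IsKillingField.isTimelike_mfderiv_flow_iff (hX : g.IsKillingField X)
    (hθ : ContMDiff (𝓘(ℝ, ℝ).prod I) I 2 θ) (hθ0 : ∀ p, θ (0, p) = p)
    (hθX : ∀ p, IsMIntegralCurve (fun t ↦ θ (t, p)) X) (t : ℝ) {p : M} (v : TangentSpace I p) :
    g.IsTimelike (mfderiv I I (fun q ↦ θ (t, q)) p v) ↔ g.IsTimelike v := by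
  simp only [LorentzianMetric.IsTimelike]
  rw [hX.val_mfderiv_flow_self hθ hθ0 hθX t p v]

/-- The flow of a Killing field (with the group law) maps causal vectors to causal vectors.
O'Neill 1983, Ch. 9, Prop. 9.23. [cite: ONeillSemiRiemannian1983, Ch. 9, Prop. 23 (p. 251)] -/
theorem IsKillingField.isCausal_mfderiv_flow (hX : g.IsKillingField X)
    (hθ : ContMDiff (𝓘(ℝ, ℝ).prod I) I 2 θ) (hθ0 : ∀ p, θ (0, p) = p)
    (hθadd : ∀ t s p, θ (t, θ (s, p)) = θ (t + s, p))
    (hθX : ∀ p, IsMIntegralCurve (fun t ↦ θ (t, p)) X) (t : ℝ) {p : M} {v : TangentSpace I p}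
    (hv : g.IsCausal v) : g.IsCausal (mfderiv I I (fun q ↦ θ (t, q)) p v) := by
  refine ⟨?_, PseudoRiemannianMetric.mfderiv_flow_ne_zero hθ hθ0 hθadd t hv.2⟩
  have h := hX.val_mfderiv_flow_self hθ hθ0 hθX t p v
  simp only [LorentzianMetric.IsCausal] at hv ⊢
  rw [h]
  exact hv.1

/-- **The flow of a Killing field preserves the time orientation**: if `v ∈ T_p M` is causal and
future-directed then so is `dθₜ v` for every `t`. The function `t ↦ g(T(θₜ p), dθₜ v)` is
continuous (`continuous_lift_mfderiv_flow`), never zero (a causal vector is never orthogonal to the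
timelike orienting field `T`) and negative at `t = 0`; by the intermediate value theorem it is
negative for all `t`. This is the (tacit) time-orientability of the isometries `φₜ[X]` in
Chruściel–Costa 2008, §2.2–§3 (e.g. Lemma 3.6, Prop. 4.1: `I^±(M_ext)` and the horizons are
invariant under the flow); O'Neill 1983, Ch. 9, Prop. 9.23 with Ch. 5, Lemma 5.26 ff. [cite: ChruscielCosta2008, §2.2 and §3 (Lemma 3.6)] -/
theorem IsKillingField.isFutureDirected_mfderiv_flow (hX : g.IsKillingField X)
    (hθ : ContMDiff (𝓘(ℝ, ℝ).prod I) I 2 θ) (hθ0 : ∀ p, θ (0, p) = p)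
    (hθadd : ∀ t s p, θ (t, θ (s, p)) = θ (t + s, p))
    (hθX : ∀ p, IsMIntegralCurve (fun t ↦ θ (t, p)) X) (t : ℝ) {p : M} {v : TangentSpace I p}
    (hv : τ.IsFutureDirected v) : τ.IsFutureDirected (mfderiv I I (fun q ↦ θ (t, q)) p v) := by
  have hc : ∀ t, g.IsCausal (mfderiv I I (fun q ↦ θ (t, q)) p v) := fun t ↦
    hX.isCausal_mfderiv_flow hθ hθ0 hθadd hθX t hv.1
  refine ⟨hc t, ?_⟩
  -- the continuous function `f t = g(T, dθₜ v)` never vanishes and is negative at `0`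
  set f : ℝ → ℝ := fun t ↦ g.val (θ (t, p)) (τ.vectorField (θ (t, p)))
    (mfderiv I I (fun q ↦ θ (t, q)) p v) with hf
  have hθp : Continuous fun t ↦ θ (t, p) :=
    hθ.continuous.comp (continuous_id.prodMk continuous_const)
  have hfc : Continuous f := by
    refine LorentzianMetric.continuous_val_of_continuous g hθp ?_
      (continuous_lift_mfderiv_flow hθ p v)
    exact τ.contMDiff.continuous.comp hθp
  have hne : ∀ t, f t ≠ 0 := fun t ↦
    g.val_ne_zero_of_isTimelike_of_isCausal (τ.isTimelike _) (hc t)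
  have hid : (fun q ↦ θ (0, q)) = id := funext hθ0
  have h0 : f 0 < 0 := by
    have h := hv.2
    simp only [hf]
    rw [hid, mfderiv_id]
    change g.val (θ (0, p)) (τ.vectorField (θ (0, p))) v < 0
    rw [hθ0 p]
    exact h
  by_contra hpos
  push Not at hpos
  obtain ⟨s, hs⟩ : (0 : ℝ) ∈ Set.range f :=
    mem_range_of_exists_le_of_exists_ge hfc ⟨0, h0.le⟩ ⟨t, hpos⟩
  exact hne s hs

/-- **The flow of a Killing field maps future timelike curves to future timelike curves.**
O'Neill 1983, Ch. 9, Prop. 9.23 with Ch. 5; Chruściel–Costa 2008, §3 (proof of Lemma 3.4: "every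
point in `𝒰⁺` lies on a future directed timelike path starting in `𝒱⁺ = φ₋₁(𝒰⁺)`").
[cite: ChruscielCosta2008, §3 (Lemma 3.4, Lemma 3.6)] -/
theorem IsKillingField.isFutureTimelikeCurveOn_flow_comp (hX : g.IsKillingField X)
    (hθ : ContMDiff (𝓘(ℝ, ℝ).prod I) I 2 θ) (hθ0 : ∀ p, θ (0, p) = p)
    (hθadd : ∀ t s p, θ (t, θ (s, p)) = θ (t + s, p))
    (hθX : ∀ p, IsMIntegralCurve (fun t ↦ θ (t, p)) X) (t : ℝ) {γ : ℝ → M} {s : Set ℝ}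
    (hγ : g.IsFutureTimelikeCurveOn τ γ s) :
    g.IsFutureTimelikeCurveOn τ ((fun q ↦ θ (t, q)) ∘ γ) s := by
  intro u hu
  obtain ⟨hd, ht, hf⟩ := hγ u hu
  have hθt := PseudoRiemannianMetric.mdifferentiableAt_flow hθ t (γ u)
  refine ⟨hθt.comp u hd, ?_, ?_⟩
  · rw [velocity_comp' hθt hd]
    exact (hX.isTimelike_mfderiv_flow_iff hθ hθ0 hθX t _).2 ht
  · rw [velocity_comp' hθt hd]
    exact hX.isFutureDirected_mfderiv_flow hθ hθ0 hθadd hθX t hf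

/-- **The flow of a Killing field maps future causal curves to future causal curves.**
O'Neill 1983, Ch. 9, Prop. 9.23; Chruściel–Costa 2008, §3. [cite: ChruscielCosta2008, §3 (Lemma 3.4, Lemma 3.6)] -/
theorem IsKillingField.isFutureCausalCurveOn_flow_comp (hX : g.IsKillingField X)
    (hθ : ContMDiff (𝓘(ℝ, ℝ).prod I) I 2 θ) (hθ0 : ∀ p, θ (0, p) = p)
    (hθadd : ∀ t s p, θ (t, θ (s, p)) = θ (t + s, p))
    (hθX : ∀ p, IsMIntegralCurve (fun t ↦ θ (t, p)) X) (t : ℝ) {γ : ℝ → M} {s : Set ℝ}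
    (hγ : g.IsFutureCausalCurveOn τ γ s) :
    g.IsFutureCausalCurveOn τ ((fun q ↦ θ (t, q)) ∘ γ) s := by
  intro u hu
  obtain ⟨hd, hf⟩ := hγ u hu
  have hθt := PseudoRiemannianMetric.mdifferentiableAt_flow hθ t (γ u)
  refine ⟨hθt.comp u hd, ?_⟩
  rw [velocity_comp' hθt hd]
  exact hX.isFutureDirected_mfderiv_flow hθ hθ0 hθadd hθX t hf

/-- **`θₜ(I⁺(A)) ⊆ I⁺(θₜ(A))`.** Chruściel–Costa 2008, §3 (proof of Lemma 3.6: the flow of the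
Killing field leaves `I^±` of an invariant set invariant). [cite: ChruscielCosta2008, Lemma 3.6 (proof)] -/
theorem IsKillingField.image_flow_chronologicalFuture_subset (hX : g.IsKillingField X)
    (hθ : ContMDiff (𝓘(ℝ, ℝ).prod I) I 2 θ) (hθ0 : ∀ p, θ (0, p) = p)
    (hθadd : ∀ t s p, θ (t, θ (s, p)) = θ (t + s, p))
    (hθX : ∀ p, IsMIntegralCurve (fun t ↦ θ (t, p)) X) (t : ℝ) (A : Set M) :
    (fun q ↦ θ (t, q)) '' g.chronologicalFuture τ A ⊆
      g.chronologicalFuture τ ((fun q ↦ θ (t, q)) '' A) := by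
  rintro _ ⟨q, ⟨p, hp, γ, a, b, hab, hγ, hpa, hqb⟩, rfl⟩
  exact ⟨θ (t, p), Set.mem_image_of_mem _ hp, (fun q ↦ θ (t, q)) ∘ γ, a, b, hab,
    hX.isFutureTimelikeCurveOn_flow_comp hθ hθ0 hθadd hθX t hγ, by simp [hpa], by simp [hqb]⟩

/-- **`θₜ(I⁺(A)) = I⁺(θₜ(A))`**: the flow of a Killing field commutes with chronological futures.
Chruściel–Costa 2008, §3 (Lemma 3.6). [cite: ChruscielCosta2008, Lemma 3.6 (proof)] -/
theorem IsKillingField.image_flow_chronologicalFuture (hX : g.IsKillingField X)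
    (hθ : ContMDiff (𝓘(ℝ, ℝ).prod I) I 2 θ) (hθ0 : ∀ p, θ (0, p) = p)
    (hθadd : ∀ t s p, θ (t, θ (s, p)) = θ (t + s, p))
    (hθX : ∀ p, IsMIntegralCurve (fun t ↦ θ (t, p)) X) (t : ℝ) (A : Set M) :
    (fun q ↦ θ (t, q)) '' g.chronologicalFuture τ A =
      g.chronologicalFuture τ ((fun q ↦ θ (t, q)) '' A) := by
  refine Set.Subset.antisymm (hX.image_flow_chronologicalFuture_subset hθ hθ0 hθadd hθX t A) ?_
  have h := hX.image_flow_chronologicalFuture_subset (τ := τ) hθ hθ0 hθadd hθX (-t)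
    ((fun q ↦ θ (t, q)) '' A)
  rw [Set.image_image] at h
  simp only [flow_neg_apply_flow hθ0 hθadd, Set.image_id'] at h
  have h' := Set.image_mono (f := fun q ↦ θ (t, q)) h
  rwa [image_flow_image_flow_neg hθ0 hθadd] at h'

/-- **`θₜ(I⁻(A)) = I⁻(θₜ(A))`** (time dual). Chruściel–Costa 2008, §3 (Lemma 3.6). [cite: ChruscielCosta2008, Lemma 3.6 (proof)] -/
theorem IsKillingField.image_flow_chronologicalPast (hX : g.IsKillingField X)
    (hθ : ContMDiff (𝓘(ℝ, ℝ).prod I) I 2 θ) (hθ0 : ∀ p, θ (0, p) = p)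
    (hθadd : ∀ t s p, θ (t, θ (s, p)) = θ (t + s, p))
    (hθX : ∀ p, IsMIntegralCurve (fun t ↦ θ (t, p)) X) (t : ℝ) (A : Set M) :
    (fun q ↦ θ (t, q)) '' g.chronologicalPast τ A =
      g.chronologicalPast τ ((fun q ↦ θ (t, q)) '' A) :=
  hX.image_flow_chronologicalFuture (τ := τ.reverse) hθ hθ0 hθadd hθX t A

end PseudoRiemannianMetric

/-! ### Invariance of `M_ext`, `⟨⟨M_ext⟩⟩`, `𝓑`, `𝓗⁺` and `𝓔⁺` under the stationary flow -/

section Orbit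

variable {X : Π x : M, TangentSpace I x} {θ : ℝ × M → M}

/-- For a flow of the `C¹` field `X` on a Hausdorff manifold without boundary, every integral
curve of `X` is a flow line: `γ t = θ(t, γ 0)`. Lee 2012, Thm. 9.12 (a). [cite: LeeSmoothManifolds2013, Thm. 9.12 (a)] -/
theorem eq_flow_of_isMIntegralCurve [T2Space M] [BoundarylessManifold I M]
    (hX : CMDiff 1 (T% X)) (hθX : ∀ p, IsMIntegralCurve (fun t ↦ θ (t, p)) X)
    (hθ0 : ∀ p, θ (0, p) = p) {γ : ℝ → M} (hγ : IsMIntegralCurve γ X) (t : ℝ) :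
    γ t = θ (t, γ 0) := by
  have h := isMIntegralCurve_Ioo_eq_of_contMDiff_boundaryless (t₀ := 0) hX hγ (hθX (γ 0))
    (by simp [hθ0])
  exact congrFun h t

/-- **`θₜ(M_ext) = M_ext`**: the orbit `⋃ₛ φₛ(A)` of a set is invariant under every flow map of the
`C¹` field (Hausdorff manifold without boundary, flow with the group law). Chruściel–Costa 2008,
§2.2 ((2.1): `M_ext := ⋃ₜ φₜ(Σ_ext)`). [cite: ChruscielCosta2008, §2.2 (2.1)] -/
theorem image_flow_stationaryOrbit [T2Space M] [BoundarylessManifold I M]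
    (hX : CMDiff 1 (T% X)) (hθX : ∀ p, IsMIntegralCurve (fun t ↦ θ (t, p)) X)
    (hθ0 : ∀ p, θ (0, p) = p) (hθadd : ∀ t s p, θ (t, θ (s, p)) = θ (t + s, p)) (t : ℝ)
    (A : Set M) : (fun q ↦ θ (t, q)) '' stationaryOrbit X A = stationaryOrbit X A := by
  ext y
  constructor
  · rintro ⟨_, ⟨γ, hγ, h0, u, rfl⟩, rfl⟩
    refine ⟨γ, hγ, h0, t + u, ?_⟩
    show γ (t + u) = θ (t, γ u)
    rw [eq_flow_of_isMIntegralCurve hX hθX hθ0 hγ u,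
      eq_flow_of_isMIntegralCurve hX hθX hθ0 hγ (t + u), hθadd]
  · rintro ⟨γ, hγ, h0, u, rfl⟩
    refine ⟨γ (u - t), ⟨γ, hγ, h0, u - t, rfl⟩, ?_⟩
    show θ (t, γ (u - t)) = γ u
    rw [eq_flow_of_isMIntegralCurve hX hθX hθ0 hγ (u - t),
      eq_flow_of_isMIntegralCurve hX hθX hθ0 hγ u, hθadd]
    congr 2
    ring

end Orbit

namespace PseudoRiemannianMetric

variable [FiniteDimensional ℝ E] [CompleteSpace E] [Fact (1 ≤ n)] [I.Boundaryless] [T2Space M]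
  {g : LorentzianMetric I n M} [g.HasLeviCivita] {τ : TimeOrientation g}
  {X : Π x : M, TangentSpace I x} {θ : ℝ × M → M}

/-- **`I⁺(M_ext)` is invariant under the stationary flow**: `θₜ(I⁺(⋃ₛ φₛ A)) = I⁺(⋃ₛ φₛ A)` for the
flow `θ` of a Killing field. Chruściel–Costa 2008, §2.2 and Lemma 3.6 (proof). [cite: ChruscielCosta2008, Lemma 3.6 (proof)] -/
theorem IsKillingField.image_flow_chronologicalFuture_stationaryOrbit (hX : g.IsKillingField X)
    (hθ : ContMDiff (𝓘(ℝ, ℝ).prod I) I 2 θ) (hθ0 : ∀ p, θ (0, p) = p)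
    (hθadd : ∀ t s p, θ (t, θ (s, p)) = θ (t + s, p))
    (hθX : ∀ p, IsMIntegralCurve (fun t ↦ θ (t, p)) X) (t : ℝ) (A : Set M) :
    (fun q ↦ θ (t, q)) '' g.chronologicalFuture τ (stationaryOrbit X A) =
      g.chronologicalFuture τ (stationaryOrbit X A) := by
  rw [hX.image_flow_chronologicalFuture hθ hθ0 hθadd hθX,
    image_flow_stationaryOrbit (hX.contMDiff.of_le (by exact_mod_cast Fact.out)) hθX hθ0 hθadd]

/-- **`I⁻(M_ext)` is invariant under the stationary flow.** Chruściel–Costa 2008, §2.2 and Lemma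
3.6 (proof). [cite: ChruscielCosta2008, Lemma 3.6 (proof)] -/
theorem IsKillingField.image_flow_chronologicalPast_stationaryOrbit (hX : g.IsKillingField X)
    (hθ : ContMDiff (𝓘(ℝ, ℝ).prod I) I 2 θ) (hθ0 : ∀ p, θ (0, p) = p)
    (hθadd : ∀ t s p, θ (t, θ (s, p)) = θ (t + s, p))
    (hθX : ∀ p, IsMIntegralCurve (fun t ↦ θ (t, p)) X) (t : ℝ) (A : Set M) :
    (fun q ↦ θ (t, q)) '' g.chronologicalPast τ (stationaryOrbit X A) =
      g.chronologicalPast τ (stationaryOrbit X A) := by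
  rw [hX.image_flow_chronologicalPast hθ hθ0 hθadd hθX,
    image_flow_stationaryOrbit (hX.contMDiff.of_le (by exact_mod_cast Fact.out)) hθX hθ0 hθadd]

/-- **The domain of outer communications is invariant under the stationary flow**:
`θₜ(⟨⟨M_ext⟩⟩) = ⟨⟨M_ext⟩⟩` for `M_ext = ⋃ₛ φₛ(A)`. Chruściel–Costa 2008, §2.2 and §4.2
("`𝒞⁺_t := φₜ(𝒞⁺)`" etc.). [cite: ChruscielCosta2008, §2.2 (2.2)] -/
theorem IsKillingField.image_flow_docOfEnd (hX : g.IsKillingField X)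
    (hθ : ContMDiff (𝓘(ℝ, ℝ).prod I) I 2 θ) (hθ0 : ∀ p, θ (0, p) = p)
    (hθadd : ∀ t s p, θ (t, θ (s, p)) = θ (t + s, p))
    (hθX : ∀ p, IsMIntegralCurve (fun t ↦ θ (t, p)) X) (t : ℝ) (A : Set M) :
    (fun q ↦ θ (t, q)) '' g.docOfEnd τ (stationaryOrbit X A) =
      g.docOfEnd τ (stationaryOrbit X A) := by
  rw [LorentzianMetric.docOfEnd, Set.image_inter (isHomeomorph_flow hθ.continuous hθ0
      hθadd t).injective,
    hX.image_flow_chronologicalFuture_stationaryOrbit hθ hθ0 hθadd hθX,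
    hX.image_flow_chronologicalPast_stationaryOrbit hθ hθ0 hθadd hθX]

/-- **The black-hole region is invariant under the stationary flow**: `θₜ(𝓑) = 𝓑`,
`𝓑 = M ∖ I⁻(M_ext)`. Chruściel–Costa 2008, §2.2 ((2.3)). [cite: ChruscielCosta2008, §2.2 (2.3)] -/
theorem IsKillingField.image_flow_blackHoleRegionOfEnd (hX : g.IsKillingField X)
    (hθ : ContMDiff (𝓘(ℝ, ℝ).prod I) I 2 θ) (hθ0 : ∀ p, θ (0, p) = p)
    (hθadd : ∀ t s p, θ (t, θ (s, p)) = θ (t + s, p))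
    (hθX : ∀ p, IsMIntegralCurve (fun t ↦ θ (t, p)) X) (t : ℝ) (A : Set M) :
    (fun q ↦ θ (t, q)) '' g.blackHoleRegionOfEnd τ (stationaryOrbit X A) =
      g.blackHoleRegionOfEnd τ (stationaryOrbit X A) := by
  rw [LorentzianMetric.blackHoleRegionOfEnd, Set.image_compl_eq (isHomeomorph_flow
      hθ.continuous hθ0 hθadd t).bijective,
    hX.image_flow_chronologicalPast_stationaryOrbit hθ hθ0 hθadd hθX]

/-- **The event horizon `𝓗⁺ = ∂𝓑` is invariant under the stationary flow** (`θₜ` is a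
homeomorphism preserving `𝓑`). Chruściel–Costa 2008, §2.2 ((2.3)) and §4.1 (Prop. 4.1: sections
"moved to their future by the isometry group"). [cite: ChruscielCosta2008, §2.2 (2.3) and Prop. 4.1] -/
theorem IsKillingField.image_flow_frontier_blackHoleRegionOfEnd (hX : g.IsKillingField X)
    (hθ : ContMDiff (𝓘(ℝ, ℝ).prod I) I 2 θ) (hθ0 : ∀ p, θ (0, p) = p)
    (hθadd : ∀ t s p, θ (t, θ (s, p)) = θ (t + s, p))
    (hθX : ∀ p, IsMIntegralCurve (fun t ↦ θ (t, p)) X) (t : ℝ) (A : Set M) :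
    (fun q ↦ θ (t, q)) '' frontier (g.blackHoleRegionOfEnd τ (stationaryOrbit X A)) =
      frontier (g.blackHoleRegionOfEnd τ (stationaryOrbit X A)) := by
  rw [(isHomeomorph_flow hθ.continuous hθ0 hθadd t).image_frontier,
    hX.image_flow_blackHoleRegionOfEnd hθ hθ0 hθadd hθX]

/-- **The future event horizon `𝓔⁺ = ∂I⁻(M_ext) ∩ I⁺(M_ext)` is invariant under the stationary
flow**: `θₜ(𝓔⁺) = 𝓔⁺`. Chruściel–Costa 2008, §2.2 ((2.6)), Lemma 3.6 (proof: "the null achronal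
boundaries `İ^∓(C) ∩ M_ext` are invariant under the flow of `X`") and Prop. 4.1
(`𝓔₀ = ⋃ₜ φₜ(S₀)`). [cite: ChruscielCosta2008, Lemma 3.6 (proof) and Prop. 4.1] -/
theorem IsKillingField.image_flow_futureEventHorizonOfEnd (hX : g.IsKillingField X)
    (hθ : ContMDiff (𝓘(ℝ, ℝ).prod I) I 2 θ) (hθ0 : ∀ p, θ (0, p) = p)
    (hθadd : ∀ t s p, θ (t, θ (s, p)) = θ (t + s, p))
    (hθX : ∀ p, IsMIntegralCurve (fun t ↦ θ (t, p)) X) (t : ℝ) (A : Set M) :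
    (fun q ↦ θ (t, q)) '' g.futureEventHorizonOfEnd τ (stationaryOrbit X A) =
      g.futureEventHorizonOfEnd τ (stationaryOrbit X A) := by
  have hh := isHomeomorph_flow hθ.continuous hθ0 hθadd t
  rw [LorentzianMetric.futureEventHorizonOfEnd, Set.image_inter hh.injective, hh.image_frontier,
    hX.image_flow_chronologicalPast_stationaryOrbit hθ hθ0 hθadd hθX,
    hX.image_flow_chronologicalFuture_stationaryOrbit hθ hθ0 hθadd hθX]

/-- Pointwise form: a flow line of the Killing field starting on `𝓔⁺` stays on `𝓔⁺` — the
tangency clause of `LorentzianMetric.IsNonDegenerateHorizon` holds for the stationary Killing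
field itself. Chruściel–Costa 2008, Lemma 3.6 and Prop. 4.1. [cite: ChruscielCosta2008, Lemma 3.6 (proof) and Prop. 4.1] -/
theorem IsKillingField.flow_mem_futureEventHorizonOfEnd (hX : g.IsKillingField X)
    (hθ : ContMDiff (𝓘(ℝ, ℝ).prod I) I 2 θ) (hθ0 : ∀ p, θ (0, p) = p)
    (hθadd : ∀ t s p, θ (t, θ (s, p)) = θ (t + s, p))
    (hθX : ∀ p, IsMIntegralCurve (fun t ↦ θ (t, p)) X) {A : Set M} {p : M}
    (hp : p ∈ g.futureEventHorizonOfEnd τ (stationaryOrbit X A)) (t : ℝ) :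
    θ (t, p) ∈ g.futureEventHorizonOfEnd τ (stationaryOrbit X A) := by
  rw [← hX.image_flow_futureEventHorizonOfEnd hθ hθ0 hθadd hθX t A]
  exact Set.mem_image_of_mem _ hp

/-- Likewise a flow line starting in `⟨⟨M_ext⟩⟩` stays in `⟨⟨M_ext⟩⟩`. Chruściel–Costa 2008,
§2.2. [cite: ChruscielCosta2008, §2.2 (2.2)] -/
theorem IsKillingField.flow_mem_docOfEnd (hX : g.IsKillingField X)
    (hθ : ContMDiff (𝓘(ℝ, ℝ).prod I) I 2 θ) (hθ0 : ∀ p, θ (0, p) = p)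
    (hθadd : ∀ t s p, θ (t, θ (s, p)) = θ (t + s, p))
    (hθX : ∀ p, IsMIntegralCurve (fun t ↦ θ (t, p)) X) {A : Set M} {p : M}
    (hp : p ∈ g.docOfEnd τ (stationaryOrbit X A)) (t : ℝ) :
    θ (t, p) ∈ g.docOfEnd τ (stationaryOrbit X A) := by
  rw [← hX.image_flow_docOfEnd hθ hθ0 hθadd hθX t A]
  exact Set.mem_image_of_mem _ hp

end PseudoRiemannianMetric

/-! ### The stationary flow of a `StationaryAFBlackHole` -/

namespace StationaryAFBlackHole

variable (𝓑 : StationaryAFBlackHole.{u}) [𝓑.metric.HasLeviCivita]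

/-- **The stationary Killing field generates a global flow by time-orientation-preserving
isometries leaving `M_ext`, `I^±(M_ext)`, `⟨⟨M_ext⟩⟩`, `𝓑`, and `𝓔⁺` invariant.** For a stationary
asymptotically flat black hole `𝓑` (complete smooth Killing field `X₀` on a Hausdorff `4`-manifold
without boundary) there is a smooth map `θ : ℝ × M → M` — the one-parameter group `φₜ[X₀]` of
Chruściel–Costa 2008, §2.2 — with `θ(0, p) = p`, `θ(t, θ(s, p)) = θ(t + s, p)`, whose curves are the
integral curves of `X₀`, such that every `φₜ = θ(t, ·)` is an infinitesimal isometry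
(`g(dφₜ v, dφₜ w) = g(v, w)`) mapping future-directed causal vectors to future-directed causal
vectors, and `φₜ(M_ext) = M_ext`, `φₜ(I^±(M_ext)) = I^±(M_ext)`, `φₜ(⟨⟨M_ext⟩⟩) = ⟨⟨M_ext⟩⟩`,
`φₜ(𝓑) = 𝓑`, `φₜ(𝓔⁺) = 𝓔⁺`. Existence of the flow: Lee 2012, Thm. 9.12
(`Literature.Geometry.Manifold.exists_contMDiff_globalFlow_of_complete`); isometries: O'Neill 1983,
Ch. 9, Prop. 9.23; invariances: Chruściel–Costa 2008, §2.2 and Lemma 3.6. [cite: ChruscielCosta2008, §2.2 (one-parameter group φₜ[X]) and Lemma 3.6] -/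
theorem exists_stationary_flow :
    ∃ θ : ℝ × 𝓑.carrier → 𝓑.carrier, ContMDiff (𝓘(ℝ, ℝ).prod (𝓡 4)) (𝓡 4) ∞ θ ∧
      (∀ p, θ (0, p) = p) ∧ (∀ t s p, θ (t, θ (s, p)) = θ (t + s, p)) ∧
      (∀ p, IsMIntegralCurve (fun t ↦ θ (t, p)) 𝓑.killing) ∧
      (∀ (t : ℝ) (p : 𝓑.carrier) (v w : TangentSpace (𝓡 4) p),
        𝓑.metric.val (θ (t, p)) (mfderiv (𝓡 4) (𝓡 4) (fun q ↦ θ (t, q)) p v)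
          (mfderiv (𝓡 4) (𝓡 4) (fun q ↦ θ (t, q)) p w) = 𝓑.metric.val p v w) ∧
      (∀ (t : ℝ) (p : 𝓑.carrier) (v : TangentSpace (𝓡 4) p),
        𝓑.timeOrientation.IsFutureDirected v →
          𝓑.timeOrientation.IsFutureDirected (mfderiv (𝓡 4) (𝓡 4) (fun q ↦ θ (t, q)) p v)) ∧
      (∀ t, (fun q ↦ θ (t, q)) '' 𝓑.Mext = 𝓑.Mext) ∧
      (∀ t, (fun q ↦ θ (t, q)) '' 𝓑.metric.chronologicalFuture 𝓑.timeOrientation 𝓑.Mext =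
        𝓑.metric.chronologicalFuture 𝓑.timeOrientation 𝓑.Mext) ∧
      (∀ t, (fun q ↦ θ (t, q)) '' 𝓑.metric.chronologicalPast 𝓑.timeOrientation 𝓑.Mext =
        𝓑.metric.chronologicalPast 𝓑.timeOrientation 𝓑.Mext) ∧
      (∀ t, (fun q ↦ θ (t, q)) '' 𝓑.doc = 𝓑.doc) ∧
      (∀ t, (fun q ↦ θ (t, q)) '' 𝓑.blackHoleRegion = 𝓑.blackHoleRegion) ∧
      ∀ t, (fun q ↦ θ (t, q)) '' 𝓑.horizon = 𝓑.horizon := by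
  have hK : 𝓑.metric.IsKillingField 𝓑.killing := 𝓑.isStationaryKilling.isKillingField
  have hKs : ContMDiff (𝓡 4) (𝓡 4).tangent ∞
      (fun x ↦ (⟨x, 𝓑.killing x⟩ : TangentBundle (𝓡 4) 𝓑.carrier)) := hK.contMDiff
  have hc : ∀ x : 𝓑.carrier, ∃ γ : ℝ → 𝓑.carrier, γ 0 = x ∧ IsMIntegralCurve γ 𝓑.killing := by
    intro x
    obtain ⟨γ, hγ, h0⟩ := 𝓑.isStationaryKilling.isCompleteVectorField x
    exact ⟨γ, h0, hγ⟩
  obtain ⟨θ, hθ, hθ0, hθadd, hθX⟩ :=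
    Literature.Geometry.Manifold.exists_contMDiff_globalFlow_of_complete (I := 𝓡 4) (n := ⊤)
      (by exact_mod_cast hKs) le_top hc
  have hθ' : ContMDiff (𝓘(ℝ, ℝ).prod (𝓡 4)) (𝓡 4) ∞ θ := by exact_mod_cast hθ
  have hθ2 : ContMDiff (𝓘(ℝ, ℝ).prod (𝓡 4)) (𝓡 4) 2 θ := hθ'.of_le (WithTop.coe_le_coe.mpr le_top)
  have hK1 : ContMDiff (𝓡 4) (𝓡 4).tangent 1
      (fun x ↦ (⟨x, 𝓑.killing x⟩ : TangentBundle (𝓡 4) 𝓑.carrier)) :=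
    hKs.of_le (WithTop.coe_le_coe.mpr le_top)
  refine ⟨θ, hθ', hθ0, hθadd, hθX, fun t p v w ↦ hK.val_mfderiv_flow hθ2 hθ0 hθX t p v w,
    fun t p v hv ↦ ?_, fun t ↦ ?_, fun t ↦ ?_, fun t ↦ ?_, fun t ↦ ?_, fun t ↦ ?_, fun t ↦ ?_⟩
  · exact hK.isFutureDirected_mfderiv_flow hθ2 hθ0 hθadd hθX t hv
  · exact image_flow_stationaryOrbit hK1 hθX hθ0 hθadd t _
  · exact hK.image_flow_chronologicalFuture_stationaryOrbit hθ2 hθ0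
      hθadd hθX t _
  · exact hK.image_flow_chronologicalPast_stationaryOrbit hθ2 hθ0
      hθadd hθX t _
  · exact hK.image_flow_docOfEnd hθ2 hθ0 hθadd hθX t _
  · exact hK.image_flow_blackHoleRegionOfEnd hθ2 hθ0 hθadd hθX t _
  · exact hK.image_flow_futureEventHorizonOfEnd hθ2 hθ0 hθadd hθX
      t _

end StationaryAFBlackHole

end Literature.Geometry.Lorentzian

end
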